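import Summits.BirchSwinnertonDyer.BirchSwinnertonDyer.Theorems.KimAtThreeShallowEqDeepSharpLattice
import Summits.BirchSwinnertonDyer.BirchSwinnertonDyer.Theorems.KimAtThreeFineKatoKPortLogSurjective
import HarnessLib

/-!
# Route `KimAtThreeKolyvagin` (W2): the per-factor TRACE-DUAL bound `p · exp*_{d_w}(H¹(L_w, T_pW)) ⊆ 𝒪_w^∨`
# (any place `w ∣ p`, any level, any reduction type; `p` odd) — the place-uniform form of the lattice input of the
# WEIGHTED compatibility (items 20396 · 19599 · 19077; cell `bsd-addord`, seat w2-c4 gen 11)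

HONEST FRAMING. Theorems only (local instances on `ℚ_v` exactly as in w2-c3's `KimAtThreeDeepUpperTowerLattice` /
this seat's `KimAtThreeShallowEqDeepSharpLattice`); nothing is closed or booked; BSD is not proved by any of this.
CONDITIONAL on ONE Literature cite fact, displayed: (S5b-tower) `PAdicHodge.exists_smul_range_expStarCoord_tower_iff_trace_log`.
`--supports` 19077 (helper).

WHY.  `KimAtThreeShallowEqDeepSharpLattice` turned the trace-dual bound into an integrality statement with w2-acc3's
inverse-different lemma, which costs `p^{v_p(m)}` — one digit too many at the ramified places of a wild level.  The
weighted compatibility (`KimAtThreeShallowEqDeepRiderOfWeightedCompat`) wants instead the TRACE-DUAL membership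
itself, uniformly in the place: **`Tr_{L_{w₀}/ℚ_v}(p · exp*_{dw}(z) · o) ∈ 𝒪_v` for every `o ∈ 𝒪_{w₀}`** — from which
the semi-local step is w2-acc3's self-duality at tame levels (`θ_r = 1`) and this seat's
`KimAtThreeShallowEqDeepWildDifferentLocal.wild_mul_symm_mem_cycIntLattice_of_forall_trace_mul_mem` at wild levels
(`θ_r = m′(1 − ζ₃)`), with NO digit lost.  This file is the engine of `KimAtThreeShallowEqDeepSharpLattice` stopped
one step earlier:
* `forall_trace_prime_mul_expStarOmegaHom_mul_mem_of_facts` (`p` odd): (S5b-tower) ⇒ ONE `e` with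
  `range(exp*_{e•dw}) = (log_ω E(L_{w₀}))^∨`, unit step `e ∈ 𝒪_v`, sharp points side `p𝒪_{w₀} ⊆ log_ω E(L_{w₀})`
  (`exists_point_padicLogPointFiniteExt_eq_prime_mul`), and `exp*_{dw} = e · exp*_{e•dw}` with `e·o ∈ 𝒪_{w₀}`.
Consumer: the weighted twin of w2-c2 g9's `…KatoParts` (this seat, sibling `KimAtThreeShallowEqDeepWeightedOfKatoV2`).

References: [Kato1993LNM1553] Ch. II §1.2.4, Thm. 1.4.1 (3)–(4); [BlochKato1990] §3 Prop. 3.8, Ex. 3.11;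
[SilvermanAEC2009] Thm. IV.6.4 (b), Prop. VII.2.2; [CasselsFrohlichANT1967] Ch. II §10 (10.2).
-/


set_option autoImplicit false
-- the Theorems namespace of a single-conjunct summit repeats the summit name by design (D-0017)
set_option linter.dupNamespace false

noncomputable section

open scoped NumberField NNReal Classical
open Field ValuativeRel IsDedekindDomain NumberField
open Literature.NumberTheory.GaloisRepresentations
open Literature.NumberTheory.GaloisRepresentations.PeriodRingData
open Literature.NumberTheory.PAdicHodge
open Literature.NumberTheory.EllipticCurves WeierstrassCurve
open Literature.NumberTheory.EllipticCurves.FormalGroupChart (padicLogPointFiniteExt)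
open Literature.NumberTheory.EllipticCurves.Kato2004.EulerSystemValues (cycLevel)
open Literature.NumberTheory.AdelicBaseChange
open Summit.BirchSwinnertonDyer.BirchSwinnertonDyer.Theorems.KimAtThreeDeepLowerExpStarOmega
open Summit.BirchSwinnertonDyer.BirchSwinnertonDyer.Theorems.KimAtThreeDeepLowerExpStarOmegaPlace
open Summit.BirchSwinnertonDyer.BirchSwinnertonDyer.Theorems.KimAtThreeDeepUpperExpStarTowerRange
open Summit.BirchSwinnertonDyer.BirchSwinnertonDyer.Theorems.KimAtThreeDeepUpperExpStarUnit
open Summit.BirchSwinnertonDyer.BirchSwinnertonDyer.Theorems.KimAtThreeDeepUpperFactorFieldNorm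
open Summit.BirchSwinnertonDyer.BirchSwinnertonDyer.Theorems.KimAtThreeDeepUpperTowerLattice
open Summit.BirchSwinnertonDyer.BirchSwinnertonDyer.Theorems.KimAtThreeSemiLocalTraceDualLocal
open Summit.BirchSwinnertonDyer.BirchSwinnertonDyer.Theorems.KimAtThreePortSharedSATCore
  (exists_padicInt_coe_eq_of_norm_le_one)
open Summit.BirchSwinnertonDyer.BirchSwinnertonDyer.Theorems.KimAtThreeFineKatoPerFactorPlaces
  (three_mem_asIdeal_extension)
open Summit.BirchSwinnertonDyer.BirchSwinnertonDyer.Theorems.KPort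
open Summit.BirchSwinnertonDyer.Rank1Residual.GaloisImage
open Summit.BirchSwinnertonDyer.Rank1Residual.GaloisImage.TameLevel (squarefree_cycLevel_zero)
open Summit.BirchSwinnertonDyer.Rank1Residual.Additive.LocalLog (padicLog)
open Summit.BirchSwinnertonDyer.Rank1Residual.Additive Summit.BirchSwinnertonDyer.Rank1Residual.Additive.BallEval
open Literature.NumberTheory.EllipticCurves.Rank1Residual
open Literature.NumberTheory.EllipticCurves.FormalGroupChart
open Rat.HeightOneSpectrum

open Summit.BirchSwinnertonDyer.BirchSwinnertonDyer.Theorems.KimAtThreeShallowEqDeepSharpLattice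

namespace Summit.BirchSwinnertonDyer.BirchSwinnertonDyer.Theorems.KimAtThreeShallowEqDeepTraceDualLattice

variable (p : ℕ) [hp : Fact p.Prime]

attribute [local instance] fact_natCast_mem_primesEquiv_symm
-- the tree's `ℚ`-algebra structure on `ℚ_v` first (see `KimAtThreeDeepUpperExpStarFacts`)
attribute [local instance 100000] NumberField.Place.instAlgebraCompletion
attribute [local instance] valuativeRelPlace topologicalSpacePlace
attribute [local instance] isNonarchimedeanLocalField_place charZero_place
attribute [local instance] padicAlgebraPlace fact_not_isUnit_place isAdicComplete_place

set_option backward.isDefEq.respectTransparency false in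
set_option maxHeartbeats 800000 in
/-- **The per-factor TRACE-DUAL bound** (`p` odd): for `W/ℚ` globally minimal, a local Néron line `d` at `v_p` with
Prop-1.2.3 binders and `hdual`, EVERY level `m = cycLevel p 0 r`, EVERY place `w₀ ∣ p` of `ℚ(ζ_m)` and every line
datum `dw` at `L_{w₀}` with (RES_w): **`Tr_{L_{w₀}/ℚ_v}(p · exp*_{dw}(z) · o) ∈ 𝒪_v` for all `z ∈ H¹(L_{w₀}, T_pW)`,
`o ∈ 𝒪_{w₀}`** — i.e. `p · exp*_{dw}(z) ∈ 𝒪_{w₀}^∨`, with no inverse different spent. CONDITIONAL on (S5b-tower).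
[cite: Kato1993LNM1553, Ch. II §1.2.4, Thm. 1.4.1 (3)–(4)] [cite: BlochKato1990, §3 Prop. 3.8, Ex. 3.11]
[cite: SilvermanAEC2009, Thm. IV.6.4 (b), VII.6.3] -/
theorem forall_trace_prime_mul_expStarOmegaHom_mul_mem_of_facts (hp2 : p ≠ 2)
    (hT₂ : exists_smul_range_expStarCoord_tower_iff_trace_log)
    (W : WeierstrassCurve ℚ) [W.IsElliptic] [W.IsGloballyMinimal]
    (d : LocalNeronLineAt W p ((primesEquiv (R := 𝓞 ℚ)).symm ⟨p, hp.out⟩))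
    (hinj : (bdRPeriodRingData (valuation_place_lt_one p ((primesEquiv (R := 𝓞 ℚ)).symm ⟨p, hp.out⟩))).CupLogInjective
      (logCyclotomic p) (localRationalTateRep W p (galRestrictPlace ((primesEquiv (R := 𝓞 ℚ)).symm ⟨p, hp.out⟩))))
    (hex : ∀ z : contOneCocycles (localRationalTateRep W p (galRestrictPlace ((primesEquiv (R := 𝓞 ℚ)).symm ⟨p, hp.out⟩))).toTopRep,
      (bdRPeriodRingData (valuation_place_lt_one p ((primesEquiv (R := 𝓞 ℚ)).symm ⟨p, hp.out⟩))).HasDualExp (logCyclotomic p)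
        (localRationalTateRep W p (galRestrictPlace ((primesEquiv (R := 𝓞 ℚ)).symm ⟨p, hp.out⟩))) fun σ => z.1 σ)
    (hdual : ∀ a : ℚ_[p], (∃ y, expStarOmegaPadicAt d hinj hex
        (((Padic.adicCompletionEquiv (𝓞 ℚ) ⟨p, hp.out⟩).symm : (((primesEquiv (R := 𝓞 ℚ)).symm ⟨p, hp.out⟩).adicCompletion ℚ) →+* ℚ_[p])) y = a) ↔
      ∀ Q : (W.baseChange ℚ_[p]).toAffine.Point, ‖a * padicLog (W.baseChange ℚ_[p]) Q‖ ≤ 1)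
    (r : Finset (HeightOneSpectrum (𝓞 ℚ)))
    (w₀ : ((primesEquiv (R := 𝓞 ℚ)).symm ⟨p, hp.out⟩).Extension (𝓞 (CyclotomicField (cycLevel p 0 r) ℚ))) :
    letI := LocalField.charZero_adicCompletion w₀.1
    letI := LocalField.adicCompletionPadicAlgebra w₀.1 p (Kw.prime_mem_asIdeal w₀)
    haveI : Fact (¬ IsUnit ((p : ℕ) : integerC (w₀.1.adicCompletion (CyclotomicField (cycLevel p 0 r) ℚ)))) := ⟨not_isUnit_natCast_integerC (LocalField.valuation_adicCompletion_natCast_lt_one w₀.1 p (Kw.prime_mem_asIdeal w₀))⟩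
    haveI := isAdicComplete_integerC_natCast (LocalField.valuation_adicCompletion_natCast_lt_one w₀.1 p (Kw.prime_mem_asIdeal w₀))
    ∀ (dw : LocalNeronLine W (LocalField.valuation_adicCompletion_natCast_lt_one w₀.1 p (Kw.prime_mem_asIdeal w₀)) ((galRestrictPlace ((primesEquiv (R := 𝓞 ℚ)).symm ⟨p, hp.out⟩)).comp (absGaloisRestrict (((primesEquiv (R := 𝓞 ℚ)).symm ⟨p, hp.out⟩).adicCompletion ℚ) (w₀.1.adicCompletion (CyclotomicField (cycLevel p 0 r) ℚ)))))
      (hinjw : (bdRPeriodRingData (LocalField.valuation_adicCompletion_natCast_lt_one w₀.1 p (Kw.prime_mem_asIdeal w₀))).CupLogInjective (logCyclotomic p) (localRationalTateRep W p ((galRestrictPlace ((primesEquiv (R := 𝓞 ℚ)).symm ⟨p, hp.out⟩)).comp (absGaloisRestrict (((primesEquiv (R := 𝓞 ℚ)).symm ⟨p, hp.out⟩).adicCompletion ℚ) (w₀.1.adicCompletion (CyclotomicField (cycLevel p 0 r) ℚ))))))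
      (hexw : ∀ z : contOneCocycles (localRationalTateRep W p ((galRestrictPlace ((primesEquiv (R := 𝓞 ℚ)).symm ⟨p, hp.out⟩)).comp (absGaloisRestrict (((primesEquiv (R := 𝓞 ℚ)).symm ⟨p, hp.out⟩).adicCompletion ℚ) (w₀.1.adicCompletion (CyclotomicField (cycLevel p 0 r) ℚ))))).toTopRep,
        (bdRPeriodRingData (LocalField.valuation_adicCompletion_natCast_lt_one w₀.1 p (Kw.prime_mem_asIdeal w₀))).HasDualExp (logCyclotomic p) (localRationalTateRep W p ((galRestrictPlace ((primesEquiv (R := 𝓞 ℚ)).symm ⟨p, hp.out⟩)).comp (absGaloisRestrict (((primesEquiv (R := 𝓞 ℚ)).symm ⟨p, hp.out⟩).adicCompletion ℚ) (w₀.1.adicCompletion (CyclotomicField (cycLevel p 0 r) ℚ))))) fun σ => z.1 σ),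
      (∀ h : (tateLocalRep W p (Sum.inr ((primesEquiv (R := 𝓞 ℚ)).symm ⟨p, hp.out⟩))).cohomology 1,
        expStarOmegaHom (LocalField.valuation_adicCompletion_natCast_lt_one w₀.1 p (Kw.prime_mem_asIdeal w₀)) ((galRestrictPlace ((primesEquiv (R := 𝓞 ℚ)).symm ⟨p, hp.out⟩)).comp (absGaloisRestrict (((primesEquiv (R := 𝓞 ℚ)).symm ⟨p, hp.out⟩).adicCompletion ℚ) (w₀.1.adicCompletion (CyclotomicField (cycLevel p 0 r) ℚ)))) dw hinjw hexw
          (ContinuousRep.cohomologyRes (tateLocalRep W p (Sum.inr ((primesEquiv (R := 𝓞 ℚ)).symm ⟨p, hp.out⟩))) (absGaloisRestrict (((primesEquiv (R := 𝓞 ℚ)).symm ⟨p, hp.out⟩).adicCompletion ℚ) (w₀.1.adicCompletion (CyclotomicField (cycLevel p 0 r) ℚ))) 1 h) =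
        algebraMap (((primesEquiv (R := 𝓞 ℚ)).symm ⟨p, hp.out⟩).adicCompletion ℚ) (w₀.1.adicCompletion (CyclotomicField (cycLevel p 0 r) ℚ)) (expStarOmegaAt d h)) →
      ∀ z, ∀ o ∈ (w₀.1.adicCompletionIntegers (CyclotomicField (cycLevel p 0 r) ℚ)), Algebra.trace (((primesEquiv (R := 𝓞 ℚ)).symm ⟨p, hp.out⟩).adicCompletion ℚ) (w₀.1.adicCompletion (CyclotomicField (cycLevel p 0 r) ℚ)) (((p : ℕ) : (w₀.1.adicCompletion (CyclotomicField (cycLevel p 0 r) ℚ))) * expStarOmegaHom (LocalField.valuation_adicCompletion_natCast_lt_one w₀.1 p (Kw.prime_mem_asIdeal w₀)) ((galRestrictPlace ((primesEquiv (R := 𝓞 ℚ)).symm ⟨p, hp.out⟩)).comp (absGaloisRestrict (((primesEquiv (R := 𝓞 ℚ)).symm ⟨p, hp.out⟩).adicCompletion ℚ) (w₀.1.adicCompletion (CyclotomicField (cycLevel p 0 r) ℚ)))) dw hinjw hexw z * o) ∈ ((primesEquiv (R := 𝓞 ℚ)).symm ⟨p, hp.out⟩).adicCompletionIntegers ℚ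 := by
  intro dw hinjw hexw hres z o ho
  letI := LocalField.charZero_adicCompletion w₀.1
  letI := LocalField.adicCompletionPadicAlgebra w₀.1 p (Kw.prime_mem_asIdeal w₀)
  haveI : Fact (¬ IsUnit ((p : ℕ) : integerC (w₀.1.adicCompletion (CyclotomicField (cycLevel p 0 r) ℚ)))) := ⟨not_isUnit_natCast_integerC (LocalField.valuation_adicCompletion_natCast_lt_one w₀.1 p (Kw.prime_mem_asIdeal w₀))⟩
  haveI := isAdicComplete_integerC_natCast (LocalField.valuation_adicCompletion_natCast_lt_one w₀.1 p (Kw.prime_mem_asIdeal w₀))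
  -- `Place.Completion (inr v₀)` is `ℚ_{v₀}` by `rfl`: read the packet's algebra structure on it
  letI instEF : Algebra (NumberField.Place.Completion (K := ℚ) (Sum.inr ((primesEquiv (R := 𝓞 ℚ)).symm ⟨p, hp.out⟩))) (w₀.1.adicCompletion (CyclotomicField (cycLevel p 0 r) ℚ)) :=
    inferInstanceAs (Algebra (((primesEquiv (R := 𝓞 ℚ)).symm ⟨p, hp.out⟩).adicCompletion ℚ) (w₀.1.adicCompletion (CyclotomicField (cycLevel p 0 r) ℚ)))
  -- a compatible `ℝ≥0`-valuation on `L_{w₀}` (the base-`p^{1/e}` norm of the synonym `Kwe`) and integrality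
  haveI hνc := Kwe.compatible_normValuation (p := p) (L := (CyclotomicField (cycLevel p 0 r) ℚ)) (w := w₀)
  haveI : (W.baseChange (w₀.1.adicCompletion (CyclotomicField (cycLevel p 0 r) ℚ))).IsIntegral
      ((NormedField.valuation : Valuation (Kwe p (CyclotomicField (cycLevel p 0 r) ℚ) w₀) ℝ≥0).comap
        (Kwe.toCompletion p (CyclotomicField (cycLevel p 0 r) ℚ) w₀).symm.toRingHom).integer :=
    Kw.isIntegral_baseChange_of_isGloballyMinimal _ W
  -- (S5b-tower): ONE rescaling `e`
  obtain ⟨e, he, hde, hrange⟩ := exists_smul_ranges_of_facts W p ((primesEquiv (R := 𝓞 ℚ)).symm ⟨p, hp.out⟩) (LocalField.valuation_adicCompletion_natCast_lt_one w₀.1 p (Kw.prime_mem_asIdeal w₀)) hT₂ d hinj hex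
    ((NormedField.valuation : Valuation (Kwe p (CyclotomicField (cycLevel p 0 r) ℚ) w₀) ℝ≥0).comap (Kwe.toCompletion p (CyclotomicField (cycLevel p 0 r) ℚ) w₀).symm.toRingHom)
    dw hinjw hexw hres (((Padic.adicCompletionEquiv (𝓞 ℚ) ⟨p, hp.out⟩).symm : (((primesEquiv (R := 𝓞 ℚ)).symm ⟨p, hp.out⟩).adicCompletion ℚ) →+* ℚ_[p]))
  -- the unit step: `e ∈ 𝒪_v`
  obtain ⟨heO, -⟩ := mem_integers_of_hdual_smul W p ((primesEquiv (R := 𝓞 ℚ)).symm ⟨p, hp.out⟩) d hinj hex _ hdual he hde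
  have hE0 : algebraMap (((primesEquiv (R := 𝓞 ℚ)).symm ⟨p, hp.out⟩).adicCompletion ℚ) (w₀.1.adicCompletion (CyclotomicField (cycLevel p 0 r) ℚ)) e ≠ 0 := (map_ne_zero _).mpr he
  have hEO : algebraMap (((primesEquiv (R := 𝓞 ℚ)).symm ⟨p, hp.out⟩).adicCompletion ℚ) (w₀.1.adicCompletion (CyclotomicField (cycLevel p 0 r) ℚ)) e ∈ (w₀.1.adicCompletionIntegers (CyclotomicField (cycLevel p 0 r) ℚ)) :=
    w₀.adicCompletionSemialgHom_image_adicCompletionIntegers ℚ (CyclotomicField (cycLevel p 0 r) ℚ) ⟨e, heO, rfl⟩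
  -- `exp*_{dw} z = E · a'` with `a' := exp*_{E•dw} z` in the trace dual of `log_ω E(L_{w₀})`
  have haa' : expStarOmegaHom (LocalField.valuation_adicCompletion_natCast_lt_one w₀.1 p (Kw.prime_mem_asIdeal w₀)) ((galRestrictPlace ((primesEquiv (R := 𝓞 ℚ)).symm ⟨p, hp.out⟩)).comp (absGaloisRestrict (((primesEquiv (R := 𝓞 ℚ)).symm ⟨p, hp.out⟩).adicCompletion ℚ) (w₀.1.adicCompletion (CyclotomicField (cycLevel p 0 r) ℚ)))) dw hinjw hexw z = algebraMap (((primesEquiv (R := 𝓞 ℚ)).symm ⟨p, hp.out⟩).adicCompletion ℚ) (w₀.1.adicCompletion (CyclotomicField (cycLevel p 0 r) ℚ)) e *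
      expStarOmegaHom (LocalField.valuation_adicCompletion_natCast_lt_one w₀.1 p (Kw.prime_mem_asIdeal w₀)) ((galRestrictPlace ((primesEquiv (R := 𝓞 ℚ)).symm ⟨p, hp.out⟩)).comp (absGaloisRestrict (((primesEquiv (R := 𝓞 ℚ)).symm ⟨p, hp.out⟩).adicCompletion ℚ) (w₀.1.adicCompletion (CyclotomicField (cycLevel p 0 r) ℚ)))) (dw.smul (algebraMap (((primesEquiv (R := 𝓞 ℚ)).symm ⟨p, hp.out⟩).adicCompletion ℚ) (w₀.1.adicCompletion (CyclotomicField (cycLevel p 0 r) ℚ)) e) ((map_ne_zero (algebraMap (((primesEquiv (R := 𝓞 ℚ)).symm ⟨p, hp.out⟩).adicCompletion ℚ) (w₀.1.adicCompletion (CyclotomicField (cycLevel p 0 r) ℚ)))).mpr he))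
        hinjw hexw z := by
    rw [expStarOmegaHom_apply, expStarOmegaHom_apply, expStarOmega_smul, ← mul_assoc, mul_inv_cancel₀ hE0, one_mul]
  have hdual' := (hrange (expStarOmegaHom (LocalField.valuation_adicCompletion_natCast_lt_one w₀.1 p (Kw.prime_mem_asIdeal w₀)) ((galRestrictPlace ((primesEquiv (R := 𝓞 ℚ)).symm ⟨p, hp.out⟩)).comp (absGaloisRestrict (((primesEquiv (R := 𝓞 ℚ)).symm ⟨p, hp.out⟩).adicCompletion ℚ) (w₀.1.adicCompletion (CyclotomicField (cycLevel p 0 r) ℚ))))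
      (dw.smul (algebraMap (((primesEquiv (R := 𝓞 ℚ)).symm ⟨p, hp.out⟩).adicCompletion ℚ) (w₀.1.adicCompletion (CyclotomicField (cycLevel p 0 r) ℚ)) e) ((map_ne_zero (algebraMap (((primesEquiv (R := 𝓞 ℚ)).symm ⟨p, hp.out⟩).adicCompletion ℚ) (w₀.1.adicCompletion (CyclotomicField (cycLevel p 0 r) ℚ)))).mpr he)) hinjw hexw z)).mp ⟨z, rfl⟩
  -- points (SHARP, `p` odd): `p 𝒪_{w₀} ⊆ log_ω E(L_{w₀})`, so `Tr(p a' · o) ∈ 𝒪_v` for every `o ∈ 𝒪_{w₀}`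
  have htr : ∀ o ∈ (w₀.1.adicCompletionIntegers (CyclotomicField (cycLevel p 0 r) ℚ)),
      Algebra.trace (((primesEquiv (R := 𝓞 ℚ)).symm ⟨p, hp.out⟩).adicCompletion ℚ) (w₀.1.adicCompletion (CyclotomicField (cycLevel p 0 r) ℚ)) ((((p : ℕ) : (w₀.1.adicCompletion (CyclotomicField (cycLevel p 0 r) ℚ))) *
        expStarOmegaHom (LocalField.valuation_adicCompletion_natCast_lt_one w₀.1 p (Kw.prime_mem_asIdeal w₀)) ((galRestrictPlace ((primesEquiv (R := 𝓞 ℚ)).symm ⟨p, hp.out⟩)).comp (absGaloisRestrict (((primesEquiv (R := 𝓞 ℚ)).symm ⟨p, hp.out⟩).adicCompletion ℚ) (w₀.1.adicCompletion (CyclotomicField (cycLevel p 0 r) ℚ)))) (dw.smul (algebraMap (((primesEquiv (R := 𝓞 ℚ)).symm ⟨p, hp.out⟩).adicCompletion ℚ) (w₀.1.adicCompletion (CyclotomicField (cycLevel p 0 r) ℚ)) e) ((map_ne_zero (algebraMap (((primesEquiv (R := 𝓞 ℚ)).symm ⟨p, hp.out⟩).adicCompletion ℚ) (w₀.1.adicCompletion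 (CyclotomicField (cycLevel p 0 r) ℚ)))).mpr he))
          hinjw hexw z) * o) ∈ ((primesEquiv (R := 𝓞 ℚ)).symm ⟨p, hp.out⟩).adicCompletionIntegers ℚ := by
    intro o ho
    obtain ⟨P', hP'⟩ := exists_point_padicLogPointFiniteExt_eq_prime_mul (p := p) (L := (CyclotomicField (cycLevel p 0 r) ℚ)) (w := w₀) W hp2
      ((NormedField.valuation : Valuation (Kwe p (CyclotomicField (cycLevel p 0 r) ℚ) w₀) ℝ≥0).comap (Kwe.toCompletion p (CyclotomicField (cycLevel p 0 r) ℚ) w₀).symm.toRingHom) o ho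
    have h1 := hdual' P'
    rw [hP', ← mul_assoc, mul_comm (expStarOmegaHom _ _ _ _ _ _) (((p : ℕ) : (w₀.1.adicCompletion (CyclotomicField (cycLevel p 0 r) ℚ)))),
      Kw.trace_adicCompletionPadicAlgebra_eq w₀ (Kw.prime_mem_asIdeal w₀)] at h1
    exact mem_adicCompletionIntegers_of_norm_symm_le_one p _ h1
  -- `exp*_{dw} z = E · a'` with `E ∈ 𝒪_{w₀}`: `Tr(p · E a' · o) = Tr(p a' · (E o))`, `E o ∈ 𝒪_{w₀}`
  rw [haa']
  have hre : ((p : ℕ) : (w₀.1.adicCompletion (CyclotomicField (cycLevel p 0 r) ℚ))) *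
      (algebraMap (((primesEquiv (R := 𝓞 ℚ)).symm ⟨p, hp.out⟩).adicCompletion ℚ) (w₀.1.adicCompletion (CyclotomicField (cycLevel p 0 r) ℚ)) e *
        expStarOmegaHom (LocalField.valuation_adicCompletion_natCast_lt_one w₀.1 p (Kw.prime_mem_asIdeal w₀)) ((galRestrictPlace ((primesEquiv (R := 𝓞 ℚ)).symm ⟨p, hp.out⟩)).comp (absGaloisRestrict (((primesEquiv (R := 𝓞 ℚ)).symm ⟨p, hp.out⟩).adicCompletion ℚ) (w₀.1.adicCompletion (CyclotomicField (cycLevel p 0 r) ℚ)))) (dw.smul (algebraMap (((primesEquiv (R := 𝓞 ℚ)).symm ⟨p, hp.out⟩).adicCompletion ℚ) (w₀.1.adicCompletion (CyclotomicField (cycLevel p 0 r) ℚ)) e) ((map_ne_zero (algebraMap (((primesEquiv (R := 𝓞 ℚ)).symm ⟨p, hp.out⟩).adicCompletion ℚ) (w₀.1.adicCompletion (CyclotomicField (cycLevel p 0 r) ℚ)))).mpr he))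
          hinjw hexw z) * o =
      ((p : ℕ) : (w₀.1.adicCompletion (CyclotomicField (cycLevel p 0 r) ℚ))) *
        expStarOmegaHom (LocalField.valuation_adicCompletion_natCast_lt_one w₀.1 p (Kw.prime_mem_asIdeal w₀)) ((galRestrictPlace ((primesEquiv (R := 𝓞 ℚ)).symm ⟨p, hp.out⟩)).comp (absGaloisRestrict (((primesEquiv (R := 𝓞 ℚ)).symm ⟨p, hp.out⟩).adicCompletion ℚ) (w₀.1.adicCompletion (CyclotomicField (cycLevel p 0 r) ℚ)))) (dw.smul (algebraMap (((primesEquiv (R := 𝓞 ℚ)).symm ⟨p, hp.out⟩).adicCompletion ℚ) (w₀.1.adicCompletion (CyclotomicField (cycLevel p 0 r) ℚ)) e) ((map_ne_zero (algebraMap (((primesEquiv (R := 𝓞 ℚ)).symm ⟨p, hp.out⟩).adicCompletion ℚ) (w₀.1.adicCompletion (CyclotomicField (cycLevel p 0 r) ℚ)))).mpr he))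
          hinjw hexw z *
        (algebraMap (((primesEquiv (R := 𝓞 ℚ)).symm ⟨p, hp.out⟩).adicCompletion ℚ) (w₀.1.adicCompletion (CyclotomicField (cycLevel p 0 r) ℚ)) e * o) := by
    ring
  rw [hre]
  exact htr _ (mul_mem hEO ho)

end Summit.BirchSwinnertonDyer.BirchSwinnertonDyer.Theorems.KimAtThreeShallowEqDeepTraceDualLattice

end
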